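import Mathlib.LinearAlgebra.Matrix.Notation
import Mathlib.LinearAlgebra.Matrix.Determinant.Basic
import Mathlib.GroupTheory.GroupAction.Quotient
import Mathlib.GroupTheory.Coset.Card
import Mathlib.GroupTheory.OrderOfElement
import Mathlib.Tactic
import HarnessLib

/-!
# Route `SylvesterTwoHeegnerIndex` (rung K7t), item 19580 `TwoAdicPairHSY`, residual `p ≡ 7 (mod 9)`:
# the KERNEL CERTIFICATE of memo THEOREM C's explicit `3`-adic computation (memo bsd-cm-two §15.5 (C-c))

Cell `b2b-bsdres`, seat x1b GEN 49 (prover-b2b-bsdres-x1b-g49-0), O12/O10 class lead; helper toward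
`stmt-BirchSwinnertonDyer-19580` (`--supports … --as helper`). PARTITION (D55): CornerF at `p = 2`
(B14/O12) × 𝒞_HSY ∩ {p ≡ 7 (mod 9)} × `p = 2` — types-the-object-of; closes no cell and no item; BSD
is not claimed. NO definition, NO named fact, NO `sorry`: explicit `2 × 2` matrices over `ℚ` only.

CONTEXT. Crux 19580 on `p ≡ 7 (mod 9)` is, modulo Hu–Shu–Yin's printed display (x1b GEN 48's fact
`HuShuYin2019.shaAnPair_mul_height_eq_two_zpow_mul_height`), EXACTLY the cell theorem "THEOREM C"
(bsd-cm-two's fact-free def `SylvesterTwoNonneg.HSYPointTwoDivisibleSevenModNine`: Hu–Shu–Yin's Heegner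
point `Y ∈ E_p(K)`, `K = ℚ(√−3)`, lies in `2·E_p(K) + E_p(K)_tors`). The memo's proof (§15.5) has three
conceptual steps — (C-a) `σ_{−1} ∈ Gal(H_{9p}/L_{(3,p)})` since `−1` is a cube; (C-b) Shimura
reciprocity `P₀^{σ_t} = [τ, ρ(t)]` (Hu–Shu–Yin Thm 2.3) reduces `σ_{−1}(P₀) = P₀` to the `3`-adic
membership (★) `ρ(√−3) ∈ ℚ₃^× · V₃ · ⟨A, W⟩`; (C-d) descent of the factor `2` through the traces —
and ONE explicit computation, (C-c): for `p ≡ 7, 16, 25 (mod 27)` put `a := 2, 1, 0` and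
`M(p) := 9·ρ(√−3)·(A^a W)⁻¹`; then `det M(p) = 1` and `M(p) ∈ U₀(3⁵)₃` (entries in `ℤ₃`, lower-left
entry in `3⁵ℤ₃`). THIS FILE PROVES (C-c) FOR EVERY INTEGER `p` IN EACH CLASS (the memo checked a
symbolic valuation table plus the `2187` residues `p ≡ 7 (9) (mod 3⁹)`); the planner's recorded
why-might-fail for the future crux item — «a slip in the CM-point/Galois-action bookkeeping for one
residue class of `p mod 27`» (CLOSURE-PATH-19580 §3/§6 E2) — is thereby removed as far as the explicit
identity goes; what remains of Theorem C outside the kernel is (C-b)/(C-d), i.e. Shimura reciprocity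
for CM points on `X_0(3⁵)` and the trace bookkeeping, for which the tree has no carrier.

THE OBJECTS (Hu–Shu–Yin 2019 §2.1–2.2, verbatim): `ρ : K → M₂(ℚ)` the normalised embedding with fixed
point `τ = (2pω − 9)/(9pω − 36)`,
`ρ(ω) = [[2p + 8 + 36/p, −4p/9 − 2 − 9/p], [9p + 36 + 144/p, −2p − 9 − 36/p]]`, so
`ρ(√−3) = ρ(1 + 2ω) = 1 + 2ρ(ω) = [[4p + 17 + 72/p, −8p/9 − 4 − 18/p], [18p + 72 + 288/p, −4p − 17 − 72/p]]`;
the Atkin–Lehner matrix `W = [[0, 1], [−3⁵, 0]]` and `A = [[28, 1/3], [3⁴, 1]]` (generators of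
`S₃ ⊂ N/ℚ^×Γ₀(3⁵)`); `U₀(3⁵) ⊂ GL₂(ℤ̂)` = `{c ≡ 0 (mod 3⁵)}`, `V = {u ∈ U₀(3⁵) : a ≡ d (mod 3)}`,
`U₀ = ⟨V, W, A⟩` the level of `X_Γ⁰ ≅ E_9 ×_ℚ K`.

HOW (★) IS ENCODED (definition-free). For an integer `p` with `3 ∤ p`, a rational matrix `X` lies in
`V₃` iff `Z := p·X ∈ M₂(ℤ₍₃₎)` with `3⁵ ∣ Z₂₁`, `3 ∣ Z₁₁ − Z₂₂`, `3 ∤ det Z` (`p` is a `3`-adic unit). Each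
certificate below exhibits an INTEGER matrix `Z` with `Z·(A^a W) = 9p·ρ(√−3)` (so `Z = p·M(p)`),
`det Z = p²` (so `det M(p) = 1`), `3⁵ ∣ Z₂₁` and `3 ∣ Z₁₁ − Z₂₂`; hence `M(p) = p⁻¹Z ∈ V₃ ∩ SL₂(ℤ₃)` and
`ρ(√−3) = 9⁻¹·M(p)·A^a W ∈ ℚ₃^× · V₃ · ⟨A, W⟩`, which is (★). (Indices are `0`-based in Lean:
`Z 1 0` is the lower-left entry.)

* `one_add_two_rhoOmega_sq`, `det_one_add_two_rhoOmega` — `ρ(√−3)² = −3`, `det ρ(√−3) = 3` (all `p ≠ 0`).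
* `thmC_cert_seven_mod_twentySeven` / `…_sixteen_…` / `…_twentyFive_…` — (C-c) for `a = 2, 1, 0`.
* `thmC_shimura_certificate` — the three classes assembled under the single hypothesis `p % 9 = 7`
  (the hypothesis of Theorem C), with `3 ∤ p`.
* §4 (APPEND, x1b GEN 49) `sum_smul_eq_two_nsmul_of_involution_fixes` — the ABSTRACT SKELETON of
  step (C-d): in any finite group `G` acting additively on `M`, the trace `∑_g g•x` of a point `x` fixed
  by an involution `σ ∈ G` is `2•y` for a `G`-INVARIANT `y` (applied with `G = Gal(H_{9p}/L_{(3,p)})`,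
  `M = E_9(H_{9p})`, `σ = σ_{−1}`, `x = P₀`: `R₁ = Tr P₀ = 2R₁′`, `R₁′ ∈ E_9(L_{(3,p)})`).

WHAT THIS IS NOT: not Theorem C (no CM point, no Galois action, no trace is in the tree); not a claim
about `p ≡ 4 (mod 9)` (there the memo shows NO coset works and `σ_{−1}` moves `P₀`); nothing here is a
named fact — every statement is a closed identity between explicit rational matrices, kernel-checked.

## References
* Y. Hu, J. Shu, H. Yin, *An explicit Gross–Zagier formula related to the Sylvester conjecture*, Trans.
  AMS 372 (2019) 6905–6925 = arXiv:1708.05266: §2.1 (`U₀(3⁵)`, `W`, `A`, `B`, `V`, `U₀`), §2.2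
  (`ρ(ω)`, `τ`, Thm 2.2, Thm 2.3 = Shimura reciprocity `P₀^{σ_t} = [τ, t]`).
* MEMO bsd-cm-two v2.6/2.7 (HOME/pub/bsd-cm/MEMO-bsd-cm-two.md) §15.5 THEOREM C, steps (C-a)–(C-d), (★),
  kit j237859 (the memo's exact table); planner memo CLOSURE-PATH-19580 (bsd-cm-plan g17) §3, §6 E2.
* Exact re-derivation: HOME/b2b-bsdres-x1b/gen49/tools/{thmC_matrix.py, gen_certs.py} (Laurent
  polynomials in `p`, rational arithmetic; the integer matrices `Z(s)` below are its output).
-/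

set_option autoImplicit false
-- the Summit-side namespace `Summit.BirchSwinnertonDyer.BirchSwinnertonDyer.…` (summit = problem) is mandated by D-0017
set_option linter.dupNamespace false

namespace Summit.BirchSwinnertonDyer.BirchSwinnertonDyer.Theorems.SylvesterTwoThmCCert

open Matrix

/-! ## §1 `ρ(√−3) = 1 + 2ρ(ω)`: square `−3`, determinant `3` -/

/-- **`ρ(√−3)² = −3`** (Hu–Shu–Yin 2019 §2.2: `ρ` is a `ℚ`-algebra embedding `K → M₂(ℚ)`, and
`(1 + 2ω)² = −3`): for every `p ≠ 0`, the matrix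
`ρ(√−3) = [[4p + 17 + 72/p, −8p/9 − 4 − 18/p], [18p + 72 + 288/p, −4p − 17 − 72/p]]` squares to `−3·1`.
[cite: HuShuYin2019, §2.2 display for ρ(ω)] -/
theorem one_add_two_rhoOmega_sq (p : ℚ) (hp : p ≠ 0) :
    !![4 * p + 17 + 72 / p, -(8 / 9) * p - 4 - 18 / p;
        18 * p + 72 + 288 / p, -(4 * p) - 17 - 72 / p] *
      !![4 * p + 17 + 72 / p, -(8 / 9) * p - 4 - 18 / p;
        18 * p + 72 + 288 / p, -(4 * p) - 17 - 72 / p] = (-3 : ℚ) • (1 : Matrix (Fin 2) (Fin 2) ℚ) := by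
  ext i j
  fin_cases i <;> fin_cases j <;> simp [Matrix.mul_apply, Fin.sum_univ_two] <;> field_simp <;> ring

/-- **`det ρ(√−3) = 3 = N_{K/ℚ}(√−3)`** for every `p ≠ 0`. [cite: HuShuYin2019, §2.2] -/
theorem det_one_add_two_rhoOmega (p : ℚ) (hp : p ≠ 0) :
    (!![4 * p + 17 + 72 / p, -(8 / 9) * p - 4 - 18 / p;
        18 * p + 72 + 288 / p, -(4 * p) - 17 - 72 / p] : Matrix (Fin 2) (Fin 2) ℚ).det = 3 := by
  rw [Matrix.det_fin_two_of]
  field_simp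
  ring

/-! ## §2 The three certificates (memo §15.5 (C-c)): `Z = p·M(p)`, `M(p) := 9·ρ(√−3)·(A^a W)⁻¹` -/

/-- **(C-c) for `p ≡ 7 (mod 27)`, `a = 2`** (`A²W = [[−2349, 811], [−6804, 2349]]`;
`M(p) = [[124p + 471 + 1728/p, −(1156p + 4391 + 16110/p)/27], [558p + 1980 + 6912/p, −(578p + 2051 + 7160/p)/3]]`,
lower-left entry `p⁻¹·3⁵·(1674s² + 1088s + 198)` for `p = 27s + 7`): there is an INTEGER matrix `Z`
(`= p·M(p)`) with `Z·(A·A·W) = 9p·ρ(√−3)`, `det Z = p²`, `3⁵ ∣ Z₂₁`, `3 ∣ Z₁₁ − Z₂₂`. Since `3 ∤ p`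
this says `M(p) ∈ V₃ ∩ SL₂(ℤ₃)` and `ρ(√−3) ∈ ℚ₃^×·V₃·A²W` — the memo's (★) on this class.
[cite: HuShuYin2019, §2.1–2.2 (ρ, A, W, V)] -/
theorem thmC_cert_seven_mod_twentySeven (p : ℤ) (hp : p % 27 = 7) :
    ∃ Z : Matrix (Fin 2) (Fin 2) ℤ,
      Z.map (Int.cast : ℤ → ℚ) *
          ((!![28, 1 / 3; 81, 1] : Matrix (Fin 2) (Fin 2) ℚ) * !![28, 1 / 3; 81, 1] * !![0, 1; -243, 0]) =
        ((9 : ℚ) * (p : ℚ)) • !![4 * (p : ℚ) + 17 + 72 / (p : ℚ), -(8 / 9) * (p : ℚ) - 4 - 18 / (p : ℚ);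
          18 * (p : ℚ) + 72 + 288 / (p : ℚ), -(4 * (p : ℚ)) - 17 - 72 / (p : ℚ)] ∧
      Z.det = p ^ 2 ∧ (3 : ℤ) ^ 5 ∣ Z 1 0 ∧ (3 : ℤ) ∣ Z 0 0 - Z 1 1 := by
  obtain ⟨s, rfl⟩ : ∃ s : ℤ, p = 27 * s + 7 := ⟨p / 27, by omega⟩
  refine ⟨!![90396 * s ^ 2 + 59589 * s + 11101, -31212 * s ^ 2 - 20575 * s - 3833;
      406782 * s ^ 2 + 264384 * s + 48114, -140454 * s ^ 2 - 91287 * s - 16613], ?_, ?_, ?_, ?_⟩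
  · have hp0 : ((27 * s + 7 : ℤ) : ℚ) ≠ 0 := by exact_mod_cast (show (27 * s + 7 : ℤ) ≠ 0 by omega)
    have hinv : ((27 * s + 7 : ℤ) : ℚ) * ((27 * s + 7 : ℤ) : ℚ)⁻¹ = 1 := mul_inv_cancel₀ hp0
    push_cast at hinv ⊢
    ext i j
    fin_cases i <;> fin_cases j <;> simp [Matrix.mul_apply, Fin.sum_univ_two]
    · linear_combination (-648 : ℚ) * hinv
    · linear_combination (162 : ℚ) * hinv
    · linear_combination (-2592 : ℚ) * hinv
    · linear_combination (648 : ℚ) * hinv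
  · rw [Matrix.det_fin_two_of]
    ring
  · exact ⟨1674 * s ^ 2 + 1088 * s + 198, by simp; ring⟩
  · exact ⟨76950 * s ^ 2 + 50292 * s + 9238, by simp; ring⟩

/-- **(C-c) for `p ≡ 16 (mod 27)`, `a = 1`** (`AW = [[−81, 28], [−243, 81]]`;
`M(p) = [[4p + 15 + 54/p, −(40p + 152 + 558/p)/27], [18p + 63 + 216/p, −(20p + 71 + 248/p)/3]]`,
lower-left entry `p⁻¹·3⁵·(54s² + 71s + 24)` for `p = 27s + 16`): an INTEGER `Z` (`= p·M(p)`) with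
`Z·(A·W) = 9p·ρ(√−3)`, `det Z = p²`, `3⁵ ∣ Z₂₁`, `3 ∣ Z₁₁ − Z₂₂`; i.e. `M(p) ∈ V₃ ∩ SL₂(ℤ₃)`,
`ρ(√−3) ∈ ℚ₃^×·V₃·AW`. [cite: HuShuYin2019, §2.1–2.2 (ρ, A, W, V)] -/
theorem thmC_cert_sixteen_mod_twentySeven (p : ℤ) (hp : p % 27 = 16) :
    ∃ Z : Matrix (Fin 2) (Fin 2) ℤ,
      Z.map (Int.cast : ℤ → ℚ) *
          ((!![28, 1 / 3; 81, 1] : Matrix (Fin 2) (Fin 2) ℚ) * !![0, 1; -243, 0]) =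
        ((9 : ℚ) * (p : ℚ)) • !![4 * (p : ℚ) + 17 + 72 / (p : ℚ), -(8 / 9) * (p : ℚ) - 4 - 18 / (p : ℚ);
          18 * (p : ℚ) + 72 + 288 / (p : ℚ), -(4 * (p : ℚ)) - 17 - 72 / (p : ℚ)] ∧
      Z.det = p ^ 2 ∧ (3 : ℤ) ^ 5 ∣ Z 1 0 ∧ (3 : ℤ) ∣ Z 0 0 - Z 1 1 := by
  obtain ⟨s, rfl⟩ : ∃ s : ℤ, p = 27 * s + 16 := ⟨p / 27, by omega⟩
  refine ⟨!![2916 * s ^ 2 + 3861 * s + 1318, -1080 * s ^ 2 - 1432 * s - 490;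
      13122 * s ^ 2 + 17253 * s + 5832, -4860 * s ^ 2 - 6399 * s - 2168], ?_, ?_, ?_, ?_⟩
  · have hp0 : ((27 * s + 16 : ℤ) : ℚ) ≠ 0 := by exact_mod_cast (show (27 * s + 16 : ℤ) ≠ 0 by omega)
    have hinv : ((27 * s + 16 : ℤ) : ℚ) * ((27 * s + 16 : ℤ) : ℚ)⁻¹ = 1 := mul_inv_cancel₀ hp0
    push_cast at hinv ⊢
    ext i j
    fin_cases i <;> fin_cases j <;> simp [Matrix.mul_apply, Fin.sum_univ_two]
    · linear_combination (-648 : ℚ) * hinv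
    · linear_combination (162 : ℚ) * hinv
    · linear_combination (-2592 : ℚ) * hinv
    · linear_combination (648 : ℚ) * hinv
  · rw [Matrix.det_fin_two_of]
    ring
  · exact ⟨54 * s ^ 2 + 71 * s + 24, by simp; ring⟩
  · exact ⟨2592 * s ^ 2 + 3420 * s + 1162, by simp; ring⟩

/-- **(C-c) for `p ≡ 25 (mod 27)`, `a = 0`** (`W = [[0, 1], [−243, 0]]`;
`M(p) = [[−8p − 36 − 162/p, −(4p + 17 + 72/p)/27], [−36p − 153 − 648/p, −(2p + 8 + 32/p)/3]]`,
lower-left entry `p⁻¹·3⁵·(−108s² − 217s − 111)` for `p = 27s + 25`): an INTEGER `Z` (`= p·M(p)`) with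
`Z·W = 9p·ρ(√−3)`, `det Z = p²`, `3⁵ ∣ Z₂₁`, `3 ∣ Z₁₁ − Z₂₂`; i.e. `M(p) ∈ V₃ ∩ SL₂(ℤ₃)`,
`ρ(√−3) ∈ ℚ₃^×·V₃·W`. [cite: HuShuYin2019, §2.1–2.2 (ρ, W, V)] -/
theorem thmC_cert_twentyFive_mod_twentySeven (p : ℤ) (hp : p % 27 = 25) :
    ∃ Z : Matrix (Fin 2) (Fin 2) ℤ,
      Z.map (Int.cast : ℤ → ℚ) * ((!![0, 1; -243, 0] : Matrix (Fin 2) (Fin 2) ℚ)) =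
        ((9 : ℚ) * (p : ℚ)) • !![4 * (p : ℚ) + 17 + 72 / (p : ℚ), -(8 / 9) * (p : ℚ) - 4 - 18 / (p : ℚ);
          18 * (p : ℚ) + 72 + 288 / (p : ℚ), -(4 * (p : ℚ)) - 17 - 72 / (p : ℚ)] ∧
      Z.det = p ^ 2 ∧ (3 : ℤ) ^ 5 ∣ Z 1 0 ∧ (3 : ℤ) ∣ Z 0 0 - Z 1 1 := by
  obtain ⟨s, rfl⟩ : ∃ s : ℤ, p = 27 * s + 25 := ⟨p / 27, by omega⟩
  refine ⟨!![-5832 * s ^ 2 - 11772 * s - 6062, -108 * s ^ 2 - 217 * s - 111;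
      -26244 * s ^ 2 - 52731 * s - 26973, -486 * s ^ 2 - 972 * s - 494], ?_, ?_, ?_, ?_⟩
  · have hp0 : ((27 * s + 25 : ℤ) : ℚ) ≠ 0 := by exact_mod_cast (show (27 * s + 25 : ℤ) ≠ 0 by omega)
    have hinv : ((27 * s + 25 : ℤ) : ℚ) * ((27 * s + 25 : ℤ) : ℚ)⁻¹ = 1 := mul_inv_cancel₀ hp0
    push_cast at hinv ⊢
    ext i j
    fin_cases i <;> fin_cases j <;> simp [Matrix.mul_apply, Fin.sum_univ_two]
    · linear_combination (-648 : ℚ) * hinv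
    · linear_combination (162 : ℚ) * hinv
    · linear_combination (-2592 : ℚ) * hinv
    · linear_combination (648 : ℚ) * hinv
  · rw [Matrix.det_fin_two_of]
    ring
  · exact ⟨-108 * s ^ 2 - 217 * s - 111, by simp; ring⟩
  · exact ⟨-1782 * s ^ 2 - 3600 * s - 1856, by simp; ring⟩

/-! ## §3 Assembly under Theorem C's hypothesis `p ≡ 7 (mod 9)` -/

/-- **Memo THEOREM C, step (C-c) = (★), for EVERY integer `p ≡ 7 (mod 9)`** (the hypothesis of
`HSYPointTwoDivisibleSevenModNine`): `3 ∤ p`, and for some `a ≤ 2` (namely `a = 2, 1, 0` as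
`p ≡ 7, 16, 25 (mod 27)`) there is an integer matrix `Z = p·M(p)` with `Z·(A^a·W) = 9p·ρ(√−3)`,
`det Z = p²`, `3⁵ ∣ Z₂₁`, `3 ∣ Z₁₁ − Z₂₂` — i.e. `M(p) := 9·ρ(√−3)·(A^a W)⁻¹ ∈ V₃ ∩ SL₂(ℤ₃)` and
`ρ(√−3) ∈ ℚ₃^× · V₃ · ⟨A, W⟩ ⊂ ℚ₃^× · (U₀)₃`. With Shimura reciprocity (Hu–Shu–Yin Thm 2.3) this is
what makes `σ_{−1}` FIX the CM point `P₀ = [τ, 1] ∈ X_Γ⁰(H_{9p})` (memo (C-b)); that step and the trace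
descent (C-d) are NOT in the tree. [cite: HuShuYin2019, Thm 2.3 and §2.1–2.2] -/
theorem thmC_shimura_certificate (p : ℤ) (hp : p % 9 = 7) :
    ¬ (3 : ℤ) ∣ p ∧
    ∃ (a : ℕ) (Z : Matrix (Fin 2) (Fin 2) ℤ), a ≤ 2 ∧
      Z.map (Int.cast : ℤ → ℚ) *
          ((!![28, 1 / 3; 81, 1] : Matrix (Fin 2) (Fin 2) ℚ) ^ a * !![0, 1; -243, 0]) =
        ((9 : ℚ) * (p : ℚ)) • !![4 * (p : ℚ) + 17 + 72 / (p : ℚ), -(8 / 9) * (p : ℚ) - 4 - 18 / (p : ℚ);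
          18 * (p : ℚ) + 72 + 288 / (p : ℚ), -(4 * (p : ℚ)) - 17 - 72 / (p : ℚ)] ∧
      Z.det = p ^ 2 ∧ (3 : ℤ) ^ 5 ∣ Z 1 0 ∧ (3 : ℤ) ∣ Z 0 0 - Z 1 1 := by
  refine ⟨by omega, ?_⟩
  have h27 : p % 27 = 7 ∨ p % 27 = 16 ∨ p % 27 = 25 := by omega
  rcases h27 with h | h | h
  · obtain ⟨Z, hZ, hrest⟩ := thmC_cert_seven_mod_twentySeven p h
    exact ⟨2, Z, le_rfl, by simpa only [pow_two] using hZ, hrest⟩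
  · obtain ⟨Z, hZ, hrest⟩ := thmC_cert_sixteen_mod_twentySeven p h
    exact ⟨1, Z, by norm_num, by simpa only [pow_one] using hZ, hrest⟩
  · obtain ⟨Z, hZ, hrest⟩ := thmC_cert_twentyFive_mod_twentySeven p h
    exact ⟨0, Z, by norm_num, by simpa only [pow_zero, one_mul] using hZ, hrest⟩

/-! ## §4 (C-d), abstract skeleton: the trace of a point fixed by an involution is twice an invariant
(APPEND, x1b GEN 49) -/

/-- **Trace doubling (memo THEOREM C, step (C-d), abstract part).** Let a finite group `G` act on an
additive commutative monoid `M` by monoid automorphisms, and let `σ ∈ G` be an involution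
(`σ ≠ 1`, `σ² = 1`) fixing `x ∈ M`. Then the trace `∑_{g ∈ G} g • x` equals `2 • y` for some
`G`-INVARIANT `y ∈ M`. (Proof: the map `g ↦ g • x` factors through `G ⧸ Stab(x)`, every fibre has
`#Stab(x)` elements, and `#Stab(x)` is even because `σ ∈ Stab(x)` has order `2`; `y` is
`(#Stab(x)/2) • ∑_{q ∈ G/Stab(x)} q • x`, invariant since `G` permutes `G ⧸ Stab(x)`.) In the memo:
`G = Gal(H_{9p}/L_{(3,p)})`, `M = E_9(H_{9p})`, `σ = σ_{−1}` (order `2`, fixing `P₀` by (C-b)+(C-c)),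
so `R₁ = Tr_{H_{9p}/L_{(3,p)}} P₀ = 2·R₁′` with `R₁′` Galois-invariant, i.e. `R₁′ ∈ E_9(L_{(3,p)})`.
[cite: HuShuYin2019, p. 10 (the trace defining R₁) and Thm 2.3] -/
theorem sum_smul_eq_two_nsmul_of_involution_fixes {G M : Type*} [Group G] [Fintype G]
    [AddCommMonoid M] [DistribMulAction G M] (σ : G) (hσ1 : σ ≠ 1) (hσ2 : σ * σ = 1)
    (x : M) (hx : σ • x = x) :
    ∃ y : M, (∀ g : G, g • y = y) ∧ ∑ g : G, g • x = 2 • y := by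
  classical
  set S : Subgroup G := MulAction.stabilizer G x with hS
  have hσS : σ ∈ S := MulAction.mem_stabilizer_iff.mpr hx
  have hord : orderOf σ = 2 := orderOf_eq_prime (by rw [pow_two]; exact hσ2) hσ1
  obtain ⟨m, hm⟩ : 2 ∣ Nat.card S := hord ▸ Subgroup.orderOf_dvd_natCard S hσS
  set f : G ⧸ S → M := MulAction.ofQuotientStabilizer G x with hf
  -- every fibre of `G → G ⧸ S` has `Nat.card S` elements
  have hfib : ∀ q : G ⧸ S,
      (Finset.univ.filter fun a : G => (a : G ⧸ S) = q).card = Nat.card S := by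
    intro q
    have e : {a : G // (a : G ⧸ S) = q} ≃ ↥S × ↥({q} : Set (G ⧸ S)) :=
      (Equiv.subtypeEquivRight fun a => Iff.rfl).trans
        (QuotientGroup.preimageMkEquivSubgroupProdSet S {q})
    have h1 : Nat.card {a : G // (a : G ⧸ S) = q} = Nat.card S := by
      rw [Nat.card_congr e, Nat.card_prod]; simp
    rw [← Fintype.card_subtype, ← Nat.card_eq_fintype_card, h1]
  have himg : (Finset.univ : Finset G).image (QuotientGroup.mk : G → G ⧸ S) = Finset.univ :=
    Finset.image_univ_of_surjective (QuotientGroup.mk_surjective)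
  have hsum : ∑ g : G, g • x = Nat.card S • ∑ q : G ⧸ S, f q := by
    calc ∑ g : G, g • x = ∑ g : G, f (g : G ⧸ S) := Finset.sum_congr rfl fun g _ => rfl
      _ = ∑ q ∈ (Finset.univ : Finset G).image (QuotientGroup.mk : G → G ⧸ S),
            (Finset.univ.filter fun a : G => (a : G ⧸ S) = q).card • f q := Finset.sum_comp _ _
      _ = ∑ q : G ⧸ S, Nat.card S • f q := by
            rw [himg]; exact Finset.sum_congr rfl fun q _ => by rw [hfib q]
      _ = Nat.card S • ∑ q : G ⧸ S, f q := by rw [Finset.smul_sum]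
  refine ⟨m • ∑ q : G ⧸ S, f q, fun g => ?_, by rw [hsum, hm, mul_smul]⟩
  rw [smul_comm, Finset.smul_sum]
  congr 1
  calc ∑ q : G ⧸ S, g • f q = ∑ q : G ⧸ S, f (g • q) :=
        Finset.sum_congr rfl fun q _ => (MulAction.ofQuotientStabilizer_smul G x g q).symm
    _ = ∑ q : G ⧸ S, f q := Equiv.sum_comp (MulAction.toPerm g) f


/-! ## §5 APPEND ⟦x1b GEN 51⟧ — (C-b)₂'s two computations: `9p·ρ(ω)`, `9p·ρ(√−3)` are INTEGRAL in `p`;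
`ρ(√−3)⁻¹ = −ρ(√−3)/3`

MEMO-bsd-cm-two v2.8 §15.5 (C-b) / §40.1 row (C-b)₂ («idele bookkeeping: `t_{−1} = k·h`, `k = √−3`,
`h = (−s⁻¹ at p; (√−3)⁻¹ at 3; units at ℓ ∤ 3p)`; `ρ(units at ℓ ∤ 3p) ⊂ GL₂(ℤ_ℓ) = U_ℓ` (entries of `ρ(ω)`
lie in `ℤ[1/(9p)]`, `det = 1`) … CELL, checkable by hand»). The only COMPUTATIONS in that row are made
kernel here, as closed identities between explicit matrices (every `p ≠ 0`): (i) `9p·ρ(ω)` and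
`9p·ρ(√−3)` have entries in `ℤ[p]` — so for an integer `p` and a prime `ℓ ∤ 3p`,
`ρ(ℤ[ω]) = ℤ·1 + ℤ·ρ(ω) ⊂ M₂(ℤ_ℓ)` and, with `det ρ(ω) = 1` (companion file `det_rhoOmega`),
`ρ(ℤ[ω] ⊗ ℤ_ℓ)^× ⊂ GL₂(ℤ_ℓ)`; (ii) `ρ(√−3)·(−ρ(√−3)/3) = 1` (from §1), the component of `h` at `3`.
The adelic statement itself (central elements and `U` act trivially on `[τ, ·]_U`) stays CELL; nothing
about Shimura reciprocity is claimed. -/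

/-- **`9p·ρ(ω) ∈ M₂(ℤ[p])`**: `9p·ρ(ω) = [[18p² + 72p + 324, −4p² − 18p − 81], [81p² + 324p + 1296,
−18p² − 81p − 324]]` — the entries of `ρ(ω)` have denominators dividing `9p` (memo (C-b)₂: «entries of
`ρ(ω)` lie in `ℤ[1/(9p)]`»). [cite: HuShuYin2019, §2.2 display for ρ(ω)] -/
theorem nine_p_smul_rhoOmega (p : ℚ) (hp : p ≠ 0) :
    (9 * p) • (!![2 * p + 8 + 36 / p, -(4 / 9) * p - 2 - 9 / p; 9 * p + 36 + 144 / p, -(2 * p) - 9 - 36 / p] :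
        Matrix (Fin 2) (Fin 2) ℚ) =
      !![18 * p ^ 2 + 72 * p + 324, -(4 * p ^ 2) - 18 * p - 81;
          81 * p ^ 2 + 324 * p + 1296, -(18 * p ^ 2) - 81 * p - 324] := by
  ext i j
  fin_cases i <;> fin_cases j <;> simp <;> field_simp <;> ring

/-- Integer form of `nine_p_smul_rhoOmega`: for an INTEGER `p ≠ 0`, `9p·ρ(ω)` is the image in `M₂(ℚ)` of an
explicit matrix of `M₂(ℤ)`. [cite: HuShuYin2019, §2.2] -/
theorem nine_p_smul_rhoOmega_int (p : ℤ) (hp : p ≠ 0) :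
    (9 * (p : ℚ)) • (!![2 * (p : ℚ) + 8 + 36 / p, -(4 / 9) * (p : ℚ) - 2 - 9 / p;
        9 * (p : ℚ) + 36 + 144 / p, -(2 * (p : ℚ)) - 9 - 36 / p] : Matrix (Fin 2) (Fin 2) ℚ) =
      (!![18 * p ^ 2 + 72 * p + 324, -(4 * p ^ 2) - 18 * p - 81;
          81 * p ^ 2 + 324 * p + 1296, -(18 * p ^ 2) - 81 * p - 324] : Matrix (Fin 2) (Fin 2) ℤ).map
        (Int.cast : ℤ → ℚ) := by
  rw [nine_p_smul_rhoOmega (p : ℚ) (by exact_mod_cast hp)]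
  ext i j
  fin_cases i <;> fin_cases j <;> simp

/-- **`9p·ρ(√−3) ∈ M₂(ℤ[p])`**: `9p·ρ(√−3) = [[36p² + 153p + 648, −8p² − 36p − 162],
[162p² + 648p + 2592, −36p² − 153p − 648]]` (`ρ(√−3) = 1 + 2ρ(ω)`). [cite: HuShuYin2019, §2.2] -/
theorem nine_p_smul_one_add_two_rhoOmega (p : ℚ) (hp : p ≠ 0) :
    (9 * p) • (!![4 * p + 17 + 72 / p, -(8 / 9) * p - 4 - 18 / p;
        18 * p + 72 + 288 / p, -(4 * p) - 17 - 72 / p] : Matrix (Fin 2) (Fin 2) ℚ) =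
      !![36 * p ^ 2 + 153 * p + 648, -(8 * p ^ 2) - 36 * p - 162;
          162 * p ^ 2 + 648 * p + 2592, -(36 * p ^ 2) - 153 * p - 648] := by
  ext i j
  fin_cases i <;> fin_cases j <;> simp <;> field_simp <;> ring

/-- **`ρ(√−3)⁻¹ = −ρ(√−3)/3`**: `ρ(√−3) · (−(1/3)·ρ(√−3)) = 1` (as `ρ(√−3)² = −3`; the component of the
idele `h` at the place `3` in memo (C-b)). [cite: HuShuYin2019, §2.2] -/
theorem one_add_two_rhoOmega_mul_neg_third_smul (p : ℚ) (hp : p ≠ 0) :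
    (!![4 * p + 17 + 72 / p, -(8 / 9) * p - 4 - 18 / p;
        18 * p + 72 + 288 / p, -(4 * p) - 17 - 72 / p] : Matrix (Fin 2) (Fin 2) ℚ) *
      ((-(1 / 3 : ℚ)) • !![4 * p + 17 + 72 / p, -(8 / 9) * p - 4 - 18 / p;
        18 * p + 72 + 288 / p, -(4 * p) - 17 - 72 / p]) = 1 := by
  rw [Matrix.mul_smul, one_add_two_rhoOmega_sq p hp, smul_smul]
  norm_num

end Summit.BirchSwinnertonDyer.BirchSwinnertonDyer.Theorems.SylvesterTwoThmCCert
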